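import Summits.Ventures.PercRepro0.ZhangLimits
import Summits.Ventures.PercRepro0.Aut

/-!
# P1 · HARRIS (Zhang's argument), part D1: symmetry of the arm events (P1 Lemma 3.1)

Cell pub-perc-repro0, seat p2 (gen 2).  On `ZhangArms / ZhangSides / ZhangLimits` (parts A–C) and p5's
`Aut.lean` (F2 for lattice automorphisms), the symmetry step of proofs/P1-harris-p1-v1.md §3:

* the rotation `ρ x = (−x₁, x₀)` by 90° about the origin and its ψ-conjugate `ρ' x = (x₁ + 1, −x₀)`
  (the rotation by 90° about the dual origin `(½, −½)`, read in p1's ψ-coordinates) as lattice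
  automorphisms `rotIso`, `rotDIso`; `ρ` fixes `E_n^+` and the spheres `∂Λ_M`, `ρ'` fixes `dn`, hence
  `ψ̂(E(Λ*_n))` and `ψ(∂Λ*_M)`;
* transport of paths and arm events under p5's `autConfig` (`T_ρ⁻¹(A^S_n) = A^{ρ S}_n`,
  `T_{ρ'}⁻¹(darmInf S n) = darmInf (ρ' S) n`) and the side cycles `L → Bo → R → T`, `T* → L* → B* → R*`;
* Lemma 3.1: `P_p(A^{S}_n) = P_p(A^L_n)` for the four primal sides (`P_armPInf_pside`) and, at `p = ½`
  through the self-duality `P_half_armDInf`, `P_½(A*^{S*}_n) = P_½(A*^{T*}_n)` for the four dual sides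
  (`P_half_armDInf_dside`).
-/

open MeasureTheory ProbabilityTheory unitInterval
open scoped ENNReal Topology

namespace Summit.Ventures.PercRepro0.Zhang

open Summit.Ventures.PercRepro0.Defs Summit.Ventures.PercRepro0.L2 Summit.Ventures.PercRepro0.DualMap
  Summit.Ventures.PercRepro0.Crossing

-- BEGIN BODY

open Summit.Ventures.PercRepro0.L2 Summit.Ventures.PercRepro0.DualMap Summit.Ventures.PercRepro0.Crossing

/-! ### §3 The two rotations as lattice automorphisms -/

/-- The rotation `ρ(x₀, x₁) = (−x₁, x₀)` by 90° about the origin, as a bijection of `ℤ²`. -/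
def rotEquiv : Vertex 2 ≃ Vertex 2 where
  toFun x := ![-(x 1), x 0]
  invFun x := ![x 1, -(x 0)]
  left_inv x := by funext i; fin_cases i <;> simp
  right_inv x := by funext i; fin_cases i <;> simp

/-- The ψ-conjugate `ρ'(x₀, x₁) = (x₁ + 1, −x₀)` of the rotation by 90° about the dual origin `(½, −½)`. -/
def rotDEquiv : Vertex 2 ≃ Vertex 2 where
  toFun x := ![x 1 + 1, -(x 0)]
  invFun x := ![-(x 1), x 0 - 1]
  left_inv x := by funext i; fin_cases i <;> simp
  right_inv x := by funext i; fin_cases i <;> simp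

/-- `(ρ x)₀ = −x₁`. -/
@[simp] theorem rotEquiv_apply_zero (x : Vertex 2) : rotEquiv x 0 = -(x 1) := rfl
/-- `(ρ x)₁ = x₀`. -/
@[simp] theorem rotEquiv_apply_one (x : Vertex 2) : rotEquiv x 1 = x 0 := rfl
/-- `(ρ⁻¹ x)₀ = x₁`. -/
@[simp] theorem rotEquiv_symm_apply_zero (x : Vertex 2) : rotEquiv.symm x 0 = x 1 := rfl
/-- `(ρ⁻¹ x)₁ = −x₀`. -/
@[simp] theorem rotEquiv_symm_apply_one (x : Vertex 2) : rotEquiv.symm x 1 = -(x 0) := rfl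
/-- `(ρ' x)₀ = x₁ + 1`. -/
@[simp] theorem rotDEquiv_apply_zero (x : Vertex 2) : rotDEquiv x 0 = x 1 + 1 := rfl
/-- `(ρ' x)₁ = −x₀`. -/
@[simp] theorem rotDEquiv_apply_one (x : Vertex 2) : rotDEquiv x 1 = -(x 0) := rfl
/-- `(ρ'⁻¹ x)₀ = −x₁`. -/
@[simp] theorem rotDEquiv_symm_apply_zero (x : Vertex 2) : rotDEquiv.symm x 0 = -(x 1) := rfl
/-- `(ρ'⁻¹ x)₁ = x₀ − 1`. -/
@[simp] theorem rotDEquiv_symm_apply_one (x : Vertex 2) : rotDEquiv.symm x 1 = x 0 - 1 := rfl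

/-- `ρ` preserves adjacency. -/
theorem adj_rotEquiv_iff (x y : Vertex 2) :
    (lattice 2).Adj (rotEquiv x) (rotEquiv y) ↔ (lattice 2).Adj x y := by
  rw [lattice_adj_iff, lattice_adj_iff]
  simp only [rotEquiv_apply_zero, rotEquiv_apply_one, neg_sub_neg, abs_sub_comm (y 1) (x 1)]
  rw [add_comm]

/-- `ρ'` preserves adjacency. -/
theorem adj_rotDEquiv_iff (x y : Vertex 2) :
    (lattice 2).Adj (rotDEquiv x) (rotDEquiv y) ↔ (lattice 2).Adj x y := by
  rw [lattice_adj_iff, lattice_adj_iff]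
  simp only [rotDEquiv_apply_zero, rotDEquiv_apply_one, neg_sub_neg, abs_sub_comm (y 0) (x 0),
    add_sub_add_right_eq_sub]
  rw [add_comm]

/-- `ρ` as a lattice automorphism (P8 Lemma 4.2). -/
def rotIso : lattice 2 ≃g lattice 2 := ⟨rotEquiv, fun {x y} => adj_rotEquiv_iff x y⟩

/-- `ρ'` as a lattice automorphism. -/
def rotDIso : lattice 2 ≃g lattice 2 := ⟨rotDEquiv, fun {x y} => adj_rotDEquiv_iff x y⟩

/-- `rotIso` acts as `rotEquiv`. -/
theorem rotIso_apply (x : Vertex 2) : rotIso x = rotEquiv x := rfl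
/-- `rotDIso` acts as `rotDEquiv`. -/
theorem rotDIso_apply (x : Vertex 2) : rotDIso x = rotDEquiv x := rfl

/-- `x ∈ ∂Λ_M` in coordinates (`d = 2`). -/
theorem mem_boundary_two {M : ℕ} {x : Vertex 2} :
    x ∈ boundary 2 M ↔ (|x 0| ≤ M ∧ |x 1| ≤ M) ∧ (|x 0| = M ∨ |x 1| = M) := by
  simp only [boundary, Set.mem_setOf_eq, Fin.forall_fin_two, Fin.exists_fin_two]

/-- `ρ` preserves the spheres `∂Λ_M`. -/
theorem rotEquiv_mem_boundary_iff {M : ℕ} (x : Vertex 2) :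
    rotEquiv x ∈ boundary 2 M ↔ x ∈ boundary 2 M := by
  simp only [mem_boundary_two, rotEquiv_apply_zero, rotEquiv_apply_one, abs_neg]
  constructor
  · rintro ⟨⟨h1, h0⟩, h | h⟩
    · exact ⟨⟨h0, h1⟩, Or.inr h⟩
    · exact ⟨⟨h0, h1⟩, Or.inl h⟩
  · rintro ⟨⟨h0, h1⟩, h | h⟩
    · exact ⟨⟨h1, h0⟩, Or.inr h⟩
    · exact ⟨⟨h1, h0⟩, Or.inl h⟩

/-- `ρ` preserves the boxes `Λ_n`. -/
theorem rotEquiv_mem_box_iff {n : ℕ} (x : Vertex 2) : rotEquiv x ∈ box 2 n ↔ x ∈ box 2 n := by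
  simp only [mem_box_two, rotEquiv_apply_zero, rotEquiv_apply_one, abs_neg, and_comm]

/-- `ρ` fixes `E_n^+`. -/
theorem bondAut_rotIso_mem_boxPlusBonds_iff (n : ℕ) (e : Sym2 (Vertex 2)) :
    bondAut rotIso e ∈ boxPlusBonds n ↔ e ∈ boxPlusBonds n := by
  induction e using Sym2.ind with
  | h x y =>
    rw [bondAut_pair]
    by_cases hb : s(x, y) ∈ bonds 2
    · have hb' : s(rotIso x, rotIso y) ∈ bonds 2 := by
        rw [← bondAut_pair, bondAut_mem_bonds]; exact hb
      rw [pair_mem_boxPlusBonds hb, pair_mem_boxPlusBonds hb', rotIso_apply, rotIso_apply,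
        rotEquiv_mem_box_iff, rotEquiv_mem_box_iff]
    · have hb' : s(rotIso x, rotIso y) ∉ bonds 2 := by
        rw [← bondAut_pair, bondAut_mem_bonds]; exact hb
      exact ⟨fun h => absurd h.1 hb', fun h => absurd h.1 hb⟩

/-- `ρ'` preserves `dn`. -/
theorem dn_rotDEquiv (x : Vertex 2) : dn (rotDEquiv x) = dn x := by
  simp only [dn, rotDEquiv_apply_zero, rotDEquiv_apply_one]
  omega

/-- `ρ'` fixes `ψ̂(E(Λ*_n))`. -/
theorem bondAut_rotDIso_mem_dualBoxBonds_iff (n : ℕ) (e : Sym2 (Vertex 2)) :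
    bondAut rotDIso e ∈ dualBoxBonds n ↔ e ∈ dualBoxBonds n := by
  induction e using Sym2.ind with
  | h x y =>
    rw [bondAut_pair, pair_mem_dualBoxBonds, pair_mem_dualBoxBonds, rotDIso_apply, rotDIso_apply]
    show dn (rotDEquiv x) ≤ n ∧ dn (rotDEquiv y) ≤ n ↔ dn x ≤ n ∧ dn y ≤ n
    rw [dn_rotDEquiv, dn_rotDEquiv]

/-- `ρ'` preserves `ψ(∂Λ*_M)`. -/
theorem rotDEquiv_mem_dualBoundary_iff {M : ℕ} (x : Vertex 2) :
    rotDEquiv x ∈ dualBoundary M ↔ x ∈ dualBoundary M := by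
  show dn (rotDEquiv x) = M ↔ dn x = M
  rw [dn_rotDEquiv]

/-! ### Transport of paths and arm events under an automorphism -/

/-- A reflexive–transitive closure is transported along a bijection `g` when the relations correspond. -/
theorem reflTransGen_equiv_iff {R R' : Vertex 2 → Vertex 2 → Prop} (g : Vertex 2 ≃ Vertex 2)
    (hR : ∀ x y, R' x y ↔ R (g x) (g y)) (u y : Vertex 2) :
    Relation.ReflTransGen R' u y ↔ Relation.ReflTransGen R (g u) (g y) := by
  constructor
  · intro h
    induction h with
    | refl => exact Relation.ReflTransGen.refl
    | tail _ hab ih => exact ih.tail ((hR _ _).1 hab)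
  · intro h
    have key : ∀ z, Relation.ReflTransGen R (g u) z → Relation.ReflTransGen R' u (g.symm z) := by
      intro z hz
      induction hz with
      | refl => rw [g.symm_apply_apply]
      | @tail a b _ hab ih =>
        refine ih.tail ((hR _ _).2 ?_)
        rwa [g.apply_symm_apply, g.apply_symm_apply]
    have := key (g y) h
    rwa [g.symm_apply_apply] at this

/-- Bonds of a transported configuration: `s(x,y) ∈ autConfig g ω ↔ s(g x, g y) ∈ ω`. -/
theorem pair_mem_autConfig (g : lattice 2 ≃g lattice 2) (ω : Config 2) (x y : Vertex 2) :
    s(x, y) ∈ autConfig g ω ↔ s(g x, g y) ∈ ω := by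
  show bondAut g s(x, y) ∈ ω ↔ _
  rw [bondAut_pair]

/-- The one-step relation `OffAdj` is transported by `ρ`. -/
theorem offAdj_autConfig_rotIso_iff (n : ℕ) (ω : Config 2) (x y : Vertex 2) :
    OffAdj n (autConfig rotIso ω) x y ↔ OffAdj n ω (rotIso x) (rotIso y) := by
  simp only [OffAdj, pair_mem_autConfig]
  rw [← bondAut_pair, bondAut_rotIso_mem_boxPlusBonds_iff, rotIso_apply, rotIso_apply,
    adj_rotEquiv_iff]

/-- The one-step relation `DAdj` is transported by `ρ'`. -/
theorem dAdj_autConfig_rotDIso_iff (n : ℕ) (ω' : Config 2) (x y : Vertex 2) :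
    DAdj n (autConfig rotDIso ω') x y ↔ DAdj n ω' (rotDIso x) (rotDIso y) := by
  simp only [DAdj, pair_mem_autConfig]
  rw [← bondAut_pair, bondAut_rotDIso_mem_dualBoxBonds_iff, rotDIso_apply, rotDIso_apply,
    adj_rotDEquiv_iff]

/-- P1 Lemma 3.1 (mechanism): `T_ρ⁻¹(A^S_{n,M}) = A^{ρ S}_{n,M}`. -/
theorem preimage_autConfig_armP (S : Set (Vertex 2)) (n M : ℕ) :
    autConfig rotIso ⁻¹' armP S n M = armP (rotEquiv '' S) n M := by
  ext ω
  simp only [Set.mem_preimage, armP, Set.mem_setOf_eq]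
  constructor
  · rintro ⟨u, hu, y, hy, hpath⟩
    refine ⟨rotEquiv u, Set.mem_image_of_mem _ hu, rotEquiv y, (rotEquiv_mem_boundary_iff y).2 hy, ?_⟩
    exact (reflTransGen_equiv_iff rotEquiv (offAdj_autConfig_rotIso_iff n ω) u y).1 hpath
  · rintro ⟨u', ⟨u, hu, rfl⟩, y', hy', hpath⟩
    refine ⟨u, hu, rotEquiv.symm y', ?_, ?_⟩
    · rw [← rotEquiv_mem_boundary_iff, rotEquiv.apply_symm_apply]; exact hy'
    · rw [reflTransGen_equiv_iff rotEquiv (offAdj_autConfig_rotIso_iff n ω), rotEquiv.apply_symm_apply]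
      exact hpath

/-- `T_ρ⁻¹(A^S_n) = A^{ρ S}_n`. -/
theorem preimage_autConfig_armPInf (S : Set (Vertex 2)) (n : ℕ) :
    autConfig rotIso ⁻¹' armPInf S n = armPInf (rotEquiv '' S) n := by
  simp only [armPInf, Set.preimage_iInter, preimage_autConfig_armP]

/-- Lemma 3.1, primal: `P_p(A^{ρ S}_n) = P_p(A^S_n)`. -/
theorem P_armPInf_image (S : Set (Vertex 2)) (n : ℕ) (p : I) :
    P 2 p (armPInf (rotEquiv '' S) n) = P 2 p (armPInf S n) := by
  rw [← preimage_autConfig_armPInf, P_autConfig_preimage rotIso p (measurableSet_armPInf S n)]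

/-- The limit dual arm event in ψ-coordinates (for a configuration playing the dual). -/
def darmInf (S : Set (Vertex 2)) (n : ℕ) : Set (Config 2) :=
  ⋂ M : ℕ, ⋂ (_ : n + 2 ≤ M), darm S n M

/-- `A*^{S*}_n` is the pull-back of `darmInf` along the dual map. -/
theorem armDInf_eq_preimage (S : Set (Vertex 2)) (n : ℕ) :
    armDInf S n = dualConfig ⁻¹' darmInf S n := by
  simp only [armDInf, darmInf, armD, Set.preimage_iInter]

/-- `darmInf S n` is measurable. -/
theorem measurableSet_darmInf (S : Set (Vertex 2)) (n : ℕ) : MeasurableSet (darmInf S n) :=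
  MeasurableSet.iInter fun M => MeasurableSet.iInter fun _ => measurableSet_darm S n M

/-- `T_{ρ'}⁻¹(darm S n M) = darm (ρ' S) n M`. -/
theorem preimage_autConfig_darm (S : Set (Vertex 2)) (n M : ℕ) :
    autConfig rotDIso ⁻¹' darm S n M = darm (rotDEquiv '' S) n M := by
  ext ω'
  simp only [Set.mem_preimage, darm, Set.mem_setOf_eq]
  constructor
  · rintro ⟨t, ht, y, hy, hpath⟩
    refine ⟨rotDEquiv t, Set.mem_image_of_mem _ ht, rotDEquiv y,
      (rotDEquiv_mem_dualBoundary_iff y).2 hy, ?_⟩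
    exact (reflTransGen_equiv_iff rotDEquiv (dAdj_autConfig_rotDIso_iff n ω') t y).1 hpath
  · rintro ⟨t', ⟨t, ht, rfl⟩, y', hy', hpath⟩
    refine ⟨t, ht, rotDEquiv.symm y', ?_, ?_⟩
    · rw [← rotDEquiv_mem_dualBoundary_iff, rotDEquiv.apply_symm_apply]; exact hy'
    · rw [reflTransGen_equiv_iff rotDEquiv (dAdj_autConfig_rotDIso_iff n ω'),
        rotDEquiv.apply_symm_apply]
      exact hpath

/-- `T_{ρ'}⁻¹(darmInf S n) = darmInf (ρ' S) n`. -/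
theorem preimage_autConfig_darmInf (S : Set (Vertex 2)) (n : ℕ) :
    autConfig rotDIso ⁻¹' darmInf S n = darmInf (rotDEquiv '' S) n := by
  simp only [darmInf, Set.preimage_iInter, preimage_autConfig_darm]

/-- Lemma 3.1, dual (ψ-coordinates): `P_p(darmInf (ρ' S) n) = P_p(darmInf S n)`. -/
theorem P_darmInf_image (S : Set (Vertex 2)) (n : ℕ) (p : I) :
    P 2 p (darmInf (rotDEquiv '' S) n) = P 2 p (darmInf S n) := by
  rw [← preimage_autConfig_darmInf, P_autConfig_preimage rotDIso p (measurableSet_darmInf S n)]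

/-- At `p = ½`: `P_½(A*^{S*}_n) = P_½(darmInf S n)` (self-duality, p1's `P_half_preimage_dualConfig`). -/
theorem P_half_armDInf (S : Set (Vertex 2)) (n : ℕ) :
    P 2 (clamp (1 / 2)) (armDInf S n) = P 2 (clamp (1 / 2)) (darmInf S n) := by
  rw [armDInf_eq_preimage, P_half_preimage_dualConfig (measurableSet_darmInf S n)]

/-! ### The side cycles `L → Bo → R → T` and `T* → L* → B* → R*` -/

/-- Membership in the image of a set under a bijection. -/
theorem mem_image_equiv_iff (g : Vertex 2 ≃ Vertex 2) (S : Set (Vertex 2)) (x : Vertex 2) :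
    x ∈ g '' S ↔ g.symm x ∈ S := by
  constructor
  · rintro ⟨y, hy, rfl⟩
    rwa [g.symm_apply_apply]
  · intro h
    exact ⟨g.symm x, h, g.apply_symm_apply x⟩

/-- `ρ(L_n) = Bo_n`. -/
theorem image_rotEquiv_leftSide (n : ℕ) : rotEquiv '' leftSide n = botSide n := by
  ext x
  simp only [mem_image_equiv_iff, leftSide, botSide, Set.mem_setOf_eq, rotEquiv_symm_apply_zero,
    rotEquiv_symm_apply_one, abs_neg]

/-- `ρ(Bo_n) = R_n`. -/
theorem image_rotEquiv_botSide (n : ℕ) : rotEquiv '' botSide n = rightSide n := by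
  ext x
  simp only [mem_image_equiv_iff, botSide, rightSide, Set.mem_setOf_eq, rotEquiv_symm_apply_zero,
    rotEquiv_symm_apply_one, neg_eq_iff_eq_neg, neg_neg]

/-- `ρ(R_n) = T_n`. -/
theorem image_rotEquiv_rightSide (n : ℕ) : rotEquiv '' rightSide n = topSide n := by
  ext x
  simp only [mem_image_equiv_iff, rightSide, topSide, Set.mem_setOf_eq, rotEquiv_symm_apply_zero,
    rotEquiv_symm_apply_one, abs_neg]

/-- `ρ'(ψ(T*_n)) = ψ(L*_n)`. -/
theorem image_rotDEquiv_topDual (n : ℕ) : rotDEquiv '' topDual n = leftDual n := by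
  ext x
  simp only [mem_image_equiv_iff, topDual, leftDual, Set.mem_setOf_eq, rotDEquiv_symm_apply_zero,
    rotDEquiv_symm_apply_one]
  omega

/-- `ρ'(ψ(L*_n)) = ψ(B*_n)`. -/
theorem image_rotDEquiv_leftDual (n : ℕ) : rotDEquiv '' leftDual n = botDual n := by
  ext x
  simp only [mem_image_equiv_iff, leftDual, botDual, Set.mem_setOf_eq, rotDEquiv_symm_apply_zero,
    rotDEquiv_symm_apply_one]
  omega

/-- `ρ'(ψ(B*_n)) = ψ(R*_n)`. -/
theorem image_rotDEquiv_botDual (n : ℕ) : rotDEquiv '' botDual n = rightDual n := by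
  ext x
  simp only [mem_image_equiv_iff, botDual, rightDual, Set.mem_setOf_eq, rotDEquiv_symm_apply_zero,
    rotDEquiv_symm_apply_one]
  omega

/-- `P_p(A^{Bo}_n) = P_p(A^L_n)`. -/
theorem P_armPInf_botSide (n : ℕ) (p : I) :
    P 2 p (armPInf (botSide n) n) = P 2 p (armPInf (leftSide n) n) := by
  rw [← image_rotEquiv_leftSide, P_armPInf_image]

/-- `P_p(A^R_n) = P_p(A^L_n)`. -/
theorem P_armPInf_rightSide (n : ℕ) (p : I) :
    P 2 p (armPInf (rightSide n) n) = P 2 p (armPInf (leftSide n) n) := by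
  rw [← image_rotEquiv_botSide, P_armPInf_image, P_armPInf_botSide]

/-- `P_p(A^T_n) = P_p(A^L_n)`. -/
theorem P_armPInf_topSide (n : ℕ) (p : I) :
    P 2 p (armPInf (topSide n) n) = P 2 p (armPInf (leftSide n) n) := by
  rw [← image_rotEquiv_rightSide, P_armPInf_image, P_armPInf_rightSide]

/-- Lemma 3.1: the four primal arm probabilities agree. -/
theorem P_armPInf_pside (n : ℕ) (p : I) (i : Fin 4) :
    P 2 p (armPInf (pside n i) n) = P 2 p (armPInf (leftSide n) n) := by
  fin_cases i
  · rfl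
  · exact P_armPInf_rightSide n p
  · exact P_armPInf_topSide n p
  · exact P_armPInf_botSide n p

/-- `P_½(A*^{L*}_n) = P_½(A*^{T*}_n)`. -/
theorem P_half_armDInf_leftDual (n : ℕ) :
    P 2 (clamp (1 / 2)) (armDInf (leftDual n) n) = P 2 (clamp (1 / 2)) (armDInf (topDual n) n) := by
  rw [P_half_armDInf, P_half_armDInf, ← image_rotDEquiv_topDual, P_darmInf_image]

/-- `P_½(A*^{B*}_n) = P_½(A*^{T*}_n)`. -/
theorem P_half_armDInf_botDual (n : ℕ) :
    P 2 (clamp (1 / 2)) (armDInf (botDual n) n) = P 2 (clamp (1 / 2)) (armDInf (topDual n) n) := by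
  rw [P_half_armDInf, P_half_armDInf, ← image_rotDEquiv_leftDual, P_darmInf_image,
    ← P_half_armDInf, P_half_armDInf_leftDual, P_half_armDInf]

/-- `P_½(A*^{R*}_n) = P_½(A*^{T*}_n)`. -/
theorem P_half_armDInf_rightDual (n : ℕ) :
    P 2 (clamp (1 / 2)) (armDInf (rightDual n) n) = P 2 (clamp (1 / 2)) (armDInf (topDual n) n) := by
  rw [P_half_armDInf, P_half_armDInf, ← image_rotDEquiv_botDual, P_darmInf_image,
    ← P_half_armDInf, P_half_armDInf_botDual, P_half_armDInf]

/-- Lemma 3.1: the four dual arm probabilities agree at `p = ½`. -/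
theorem P_half_armDInf_dside (n : ℕ) (i : Fin 4) :
    P 2 (clamp (1 / 2)) (armDInf (dside n i) n) = P 2 (clamp (1 / 2)) (armDInf (topDual n) n) := by
  fin_cases i
  · rfl
  · exact P_half_armDInf_botDual n
  · exact P_half_armDInf_leftDual n
  · exact P_half_armDInf_rightDual n


-- END BODY

end Summit.Ventures.PercRepro0.Zhang
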